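import Literature.Analysis.FunctionSpaces.PolchinskiSmoothedJets
import Literature.Analysis.FunctionSpaces.PolchinskiTemperedFamily
import Literature.Analysis.FunctionSpaces.PolchinskiExchangeIneq
import HarnessLib

/-!
# The entropy production formula `d/dt E_{ν_t}[Φ(P_{0,t}F)] = −½E_{ν_t}[Φ″(P_{0,t}F)(∇P_{0,t}F)²_{Ċ_t}]`
# for initial Boltzmann weights `e^{−V₀} = Ψ` of the smoothed class (Bauerschmidt–Bodineau–Dagallier,
# proof of Theorem 3, (e:dEnt), when `V₀` is unbounded above)

Topic `Literature/Analysis/FunctionSpaces`; "proof architecture" file behind the named fact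
`Polchinski.BauerschmidtBodineau_multiscaleBakryEmery` ([BBD] Theorem 3, `MultiscaleBakryEmery.lean`).

`PolchinskiEntropyDerivative.lean` proves (e:dEnt) for `V₀ ∈ C_b⁴` by differentiating the `ν_t`-average
of the `C_b²` family `G_s = Φ(P_{0,s}F)`.  When `V₀` is only bounded below (the printed generality of
[BBD] Thm 3), `P_{0,t}F = W_t/Z_t` has unbounded derivatives and `G_s` is not `C_b²`; but after a restart
`e^{−V₀} = Ψ` belongs to the smoothed class (`PolchinskiSmoothedPotential.lean`: `C^∞`, `0 < Ψ ≤ B`, every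
derivative `Ψ`-dominated, Gaussian lower bound), and then the `e^{−V_t}`-WEIGHTED family
`K_s = Z_s Φ(W_s/Z_s)` IS `C_b²` (jet × tame, `PolchinskiTameCalculus.lean`, `PolchinskiSmoothedJets.lean`),
its time slope is tempered (`|K_s − K_t − (s−t)K̇| ≤ ε|s−t|e^{a‖y‖²}` for every `a > 0`), and the
tempered family rule `hasDerivAt_integral_family_Cinf_sub_of_sqExp` (`PolchinskiTemperedFamily.lean`)
differentiates `E_{ν_s}[Φ(P_{0,s}F)] = e^{V_∞(0)}E_{C_∞−C_s}[K_s]`.  The integrand collapses to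
`−½ e^{−V_t}Φ″(P_{0,t}F)(∇P_{0,t}F)²_{Ċ_t}` by the generator identity in jet form (`jet_generator`),
exactly as in the bounded case ([BBD] p0016 L47–75).

## Main result (sorry-free; no new definitions, no new named facts)

* **`hasDerivAt_renormExpect_comp_semigroup_smoothed`** — for `t > 0`, `e^{−V₀} = Ψ` in the smoothed
  class, `F ∈ C_b⁸` with `0 < a ≤ F ≤ b`, `Φ ∈ C³` with `Φ, Φ′, Φ″, Φ‴` bounded:
  `d/ds|_{s=t} E_{ν_s}[Φ(P_{0,s}F)] = −E_{ν_t}[½ Φ″(P_{0,t}F) Σ Ċ_t^{ij} ∂_iP_{0,t}F ∂_jP_{0,t}F]`.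

Nothing here concerns Yang–Mills (no gauge instance of (e:assCt-mon) is in print; R4 = `BalabanLadder.UV`
only).

## References

* [BauerschmidtBodineauDagallier2023] R. Bauerschmidt, T. Bodineau, B. Dagallier, Probab. Surveys 21
  (2024) 200–290, arXiv:2307.07619 — Theorem 3 proof p0016 L40–75 ((e:dEnt)), Prop 8 proof p0015.
  READ (held text `paper:arxiv-2307.07619`).
* [BauerschmidtBodineau2021] R. Bauerschmidt, T. Bodineau, Comm. Pure Appl. Math. 74 (2021) — Thm 5/6,
  general `V₀` (held text `paper:arxiv-1907.12308`, p0008–p0010).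
-/

noncomputable section

-- nested operator-norm instances `E →L[ℝ] E →L[ℝ] E →L[ℝ] ℝ`
set_option maxSynthPendingDepth 4

open MeasureTheory ProbabilityTheory Filter Topology Set
open scoped RealInnerProductSpace Matrix MatrixOrder

namespace Literature.Analysis.FunctionSpaces

namespace Polchinski

variable {N : ℕ}

/-! ### Helpers -/

section Helpers

/-- Second-order Taylor bound from a Lipschitz derivative: `|Φ(v) − Φ(u) − Φ′(u)(v−u)| ≤ P₂ (v−u)²`
(Taylor's theorem with the mean-value form of the remainder). [cite: Rudin1976, Thm 5.15] -/
theorem abs_taylor₂_le {Φ Φ' : ℝ → ℝ} (hΦ1 : ∀ x, HasDerivAt Φ (Φ' x) x) {P2 : ℝ} (hP2 : 0 ≤ P2)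
    (hLip : ∀ x y, |Φ' x - Φ' y| ≤ P2 * |x - y|) (u v : ℝ) :
    |Φ v - Φ u - Φ' u * (v - u)| ≤ P2 * (v - u) ^ 2 := by
  -- `g(x) = Φ(x) − Φ′(u) x` has derivative `Φ′(x) − Φ′(u)`, bounded by `P₂|v − u|` on `[u, v]`
  have hg : ∀ x, HasDerivAt (fun x => Φ x - Φ' u * x) (Φ' x - Φ' u) x := fun x => by
    have h := (hΦ1 x).sub ((hasDerivAt_id x).const_mul (Φ' u))
    rw [mul_one] at h
    exact h
  have hbound : ∀ x ∈ segment ℝ u v, ‖Φ' x - Φ' u‖ ≤ P2 * |v - u| := by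
    intro x hx
    rw [segment_eq_uIcc] at hx
    rw [Real.norm_eq_abs]
    refine (hLip x u).trans (mul_le_mul_of_nonneg_left ?_ hP2)
    have h := abs_sub_le_of_uIcc_subset_uIcc (uIcc_subset_uIcc_left hx)
    rwa [abs_sub_comm x u, abs_sub_comm] at h
  have h := Convex.norm_image_sub_le_of_norm_hasDerivWithin_le (𝕜 := ℝ)
    (fun x _ => (hg x).hasDerivWithinAt) hbound (convex_segment u v)
    (left_mem_segment ℝ u v) (right_mem_segment ℝ u v)
  rw [Real.norm_eq_abs, Real.norm_eq_abs] at h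
  have he : Φ v - Φ' u * v - (Φ u - Φ' u * u) = Φ v - Φ u - Φ' u * (v - u) := by ring
  rw [he] at h
  calc _ ≤ P2 * |v - u| * |v - u| := h
    _ = P2 * (v - u) ^ 2 := by rw [mul_assoc, ← sq, sq_abs]

/-- **Gaussian lower bound for a smoothed atom**: if `Ψ ≥ c₁e^{−c₂‖x‖²}` with `c₁ > 0`, then for every
probability measure `P` there is `m > 0` with `E_P[Ψ(y+·)] ≥ m e^{−2c₂‖y‖²}` for all `y`
(`‖y+ζ‖² ≤ 2‖y‖² + 2‖ζ‖²`). [cite: BauerschmidtBodineauDagallier2023, Definition 2] -/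
theorem exists_mul_exp_neg_le_atom {Ψ : EuclideanSpace ℝ (Fin N) → ℝ} (hΨc : Continuous Ψ) {B : ℝ}
    (hΨB : ∀ x, |Ψ x| ≤ B) {c₁ c₂ : ℝ} (hc₁ : 0 < c₁) (hc₂ : 0 ≤ c₂)
    (hlow : ∀ x, c₁ * Real.exp (-(c₂ * ‖x‖ ^ 2)) ≤ Ψ x)
    (P : Measure (EuclideanSpace ℝ (Fin N))) [IsProbabilityMeasure P] :
    ∃ m : ℝ, 0 < m ∧ ∀ y, m * Real.exp (-(2 * c₂ * ‖y‖ ^ 2)) ≤ ∫ ζ, Ψ (y + ζ) ∂P := by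
  have hgc : Continuous fun ζ : EuclideanSpace ℝ (Fin N) => Real.exp (-(2 * c₂ * ‖ζ‖ ^ 2)) := by
    fun_prop
  have hgi : Integrable (fun ζ : EuclideanSpace ℝ (Fin N) => Real.exp (-(2 * c₂ * ‖ζ‖ ^ 2))) P :=
    Integrable.of_bound hgc.aestronglyMeasurable 1 (Eventually.of_forall fun ζ => by
      rw [Real.norm_eq_abs, abs_of_pos (Real.exp_pos _)]
      exact Real.exp_le_one_iff.2 (by nlinarith [norm_nonneg ζ]))
  have hgpos : 0 < ∫ ζ, Real.exp (-(2 * c₂ * ‖ζ‖ ^ 2)) ∂P := integral_exp_pos hgi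
  refine ⟨c₁ * ∫ ζ, Real.exp (-(2 * c₂ * ‖ζ‖ ^ 2)) ∂P, mul_pos hc₁ hgpos, fun y => ?_⟩
  have hI : Integrable (fun ζ => Ψ (y + ζ)) P :=
    Integrable.of_bound (hΨc.comp (continuous_const.add continuous_id)).aestronglyMeasurable B
      (Eventually.of_forall fun ζ => by rw [Real.norm_eq_abs]; exact hΨB _)
  have hpt : ∀ ζ : EuclideanSpace ℝ (Fin N),
      c₁ * Real.exp (-(2 * c₂ * ‖y‖ ^ 2)) * Real.exp (-(2 * c₂ * ‖ζ‖ ^ 2)) ≤ Ψ (y + ζ) := by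
    intro ζ
    refine le_trans ?_ (hlow (y + ζ))
    rw [mul_assoc, ← Real.exp_add]
    refine mul_le_mul_of_nonneg_left (Real.exp_le_exp.2 ?_) hc₁.le
    have h := norm_add_le y ζ
    have h2 : ‖y + ζ‖ ^ 2 ≤ 2 * ‖y‖ ^ 2 + 2 * ‖ζ‖ ^ 2 := by
      nlinarith [norm_nonneg (y + ζ), norm_nonneg y, norm_nonneg ζ, sq_nonneg (‖y‖ - ‖ζ‖)]
    nlinarith
  calc c₁ * (∫ ζ, Real.exp (-(2 * c₂ * ‖ζ‖ ^ 2)) ∂P) * Real.exp (-(2 * c₂ * ‖y‖ ^ 2))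
      = ∫ ζ, c₁ * Real.exp (-(2 * c₂ * ‖y‖ ^ 2)) * Real.exp (-(2 * c₂ * ‖ζ‖ ^ 2)) ∂P := by
        rw [integral_const_mul]; ring
    _ ≤ ∫ ζ, Ψ (y + ζ) ∂P := integral_mono (hgi.const_mul _) hI hpt

/-- **Uniform continuity of a second derivative from packs of the first partials**: if `K1 = DK`,
`K2 = DK1`, the scalar partials `K1(·)e_j` coincide with functions `Kj` having two derivatives with
`‖D²Kj‖` bounded, then `K2` is uniformly continuous (its matrix elements are Lipschitz).
[cite: BauerschmidtBodineauDagallier2023, Theorem 3 (proof)] -/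
theorem uniformContinuous_of_partial_packs {K : EuclideanSpace ℝ (Fin N) → ℝ}
    {K1 : EuclideanSpace ℝ (Fin N) → EuclideanSpace ℝ (Fin N) →L[ℝ] ℝ}
    {K2 : EuclideanSpace ℝ (Fin N) → EuclideanSpace ℝ (Fin N) →L[ℝ] EuclideanSpace ℝ (Fin N) →L[ℝ] ℝ}
    (h2 : ∀ x, HasFDerivAt K1 (K2 x) x)
    {Kj : Fin N → EuclideanSpace ℝ (Fin N) → ℝ}
    {Kj1 : Fin N → EuclideanSpace ℝ (Fin N) → EuclideanSpace ℝ (Fin N) →L[ℝ] ℝ}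
    {Kj2 : Fin N → EuclideanSpace ℝ (Fin N) → EuclideanSpace ℝ (Fin N) →L[ℝ] EuclideanSpace ℝ (Fin N) →L[ℝ] ℝ}
    (hKj : ∀ j x, K1 x (EuclideanSpace.single j 1) = Kj j x)
    (hj1 : ∀ j x, HasFDerivAt (Kj j) (Kj1 j x) x) (hj2 : ∀ j x, HasFDerivAt (Kj1 j) (Kj2 j x) x)
    (hL : ∀ j, ∃ L : ℝ, ∀ x, ‖Kj2 j x‖ ≤ L) (_hK : ∀ x, HasFDerivAt K (K1 x) x) :
    UniformContinuous K2 := by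
  choose L hL using hL
  -- `K2 x v e_j = Kj1 j x v`
  have hcol : ∀ j x, Kj1 j x = (ContinuousLinearMap.apply ℝ ℝ (EuclideanSpace.single j 1)).comp (K2 x) := by
    intro j x
    have hc := (ContinuousLinearMap.apply ℝ ℝ (EuclideanSpace.single j 1)).hasFDerivAt.comp x (h2 x)
    have hfun : (⇑(ContinuousLinearMap.apply ℝ ℝ (EuclideanSpace.single j 1)) ∘ K1) = Kj j := by
      funext y; simp [Function.comp, hKj j y]
    rw [hfun] at hc
    exact (hj1 j x).unique hc
  have hel : ∀ i j x, K2 x (EuclideanSpace.single i 1) (EuclideanSpace.single j 1) =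
      Kj1 j x (EuclideanSpace.single i 1) := by
    intro i j x
    rw [hcol j x]
    simp
  have hB : ∀ i j x, HasFDerivAt
      (fun x => K2 x (EuclideanSpace.single i 1) (EuclideanSpace.single j 1))
      ((ContinuousLinearMap.apply ℝ ℝ (EuclideanSpace.single i 1)).comp (Kj2 j x)) x := by
    intro i j x
    have hfun : (fun x => K2 x (EuclideanSpace.single i 1) (EuclideanSpace.single j 1)) =
        (⇑(ContinuousLinearMap.apply ℝ ℝ (EuclideanSpace.single i 1)) ∘ Kj1 j) := by
      funext y; simp [Function.comp, hel i j y]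
    rw [hfun]
    exact (ContinuousLinearMap.apply ℝ ℝ (EuclideanSpace.single i 1)).hasFDerivAt.comp x (hj2 j x)
  refine uniformContinuous_of_matrix_elements hB (L := ∑ j, |L j|) fun i j x => ?_
  calc ‖(ContinuousLinearMap.apply ℝ ℝ (EuclideanSpace.single i 1)).comp (Kj2 j x)‖
      ≤ ‖ContinuousLinearMap.apply ℝ ℝ (EuclideanSpace.single i 1)‖ * ‖Kj2 j x‖ :=
        ContinuousLinearMap.opNorm_comp_le _ _
    _ ≤ 1 * |L j| := by
        refine mul_le_mul ?_ ((hL j x).trans (le_abs_self _)) (norm_nonneg _) zero_le_one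
        refine ContinuousLinearMap.opNorm_le_bound _ zero_le_one fun f => ?_
        rw [ContinuousLinearMap.apply_apply, one_mul]
        have h := f.le_opNorm (EuclideanSpace.single i 1)
        rwa [Cb4.norm_single_one, mul_one] at h
    _ ≤ ∑ j, |L j| := by
        rw [one_mul]
        exact Finset.single_le_sum (f := fun j => |L j|) (fun _ _ => abs_nonneg _) (Finset.mem_univ j)

/-- `Ψ`-domination of the second partials `x ↦ D²G(x)(v, w)` (as partials of partials).
[cite: Rudin1976, Thm 9.19] -/
theorem dominated_partial₂ {Ψ G : EuclideanSpace ℝ (Fin N) → ℝ} {BG : ℝ} {M : ℕ} (hM : 2 ≤ M)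
    (hG : ContDiff ℝ ((M + 2 : ℕ) : WithTop ℕ∞) G)
    (hBG : ∀ n ≤ M + 2, ∀ x, ‖iteratedFDeriv ℝ n G x‖ ≤ BG)
    (hwG : ∀ n ≤ M + 2, ∀ δ : ℝ, 0 < δ → ∃ c : ℝ, 0 ≤ c ∧
      ∀ (P : Measure (EuclideanSpace ℝ (Fin N))) [IsProbabilityMeasure P] (y : EuclideanSpace ℝ (Fin N)),
        ∫ ζ, ‖iteratedFDeriv ℝ n G (y + ζ)‖ ∂P ≤ c * (∫ ζ, Ψ (y + ζ) ∂P) ^ (1 - δ))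
    (v w : EuclideanSpace ℝ (Fin N)) :
    ContDiff ℝ M (fun x => fderiv ℝ (fderiv ℝ G) x v w) ∧
    (∀ n ≤ M, ∀ x, ‖iteratedFDeriv ℝ n (fun x => fderiv ℝ (fderiv ℝ G) x v w) x‖ ≤ ‖w‖ * (‖v‖ * BG)) ∧
    (∀ n ≤ M, ∀ δ : ℝ, 0 < δ → ∃ c : ℝ, 0 ≤ c ∧
      ∀ (P : Measure (EuclideanSpace ℝ (Fin N))) [IsProbabilityMeasure P] (y : EuclideanSpace ℝ (Fin N)),
        ∫ ζ, ‖iteratedFDeriv ℝ n (fun x => fderiv ℝ (fderiv ℝ G) x v w) (y + ζ)‖ ∂P ≤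
          c * (∫ ζ, Ψ (y + ζ) ∂P) ^ (1 - δ)) := by
  have h1 := dominated_partial (M := M + 1) (Ψ := Ψ) hG hBG hwG v
  have h2 := dominated_partial (M := M) (Ψ := Ψ) h1.1 h1.2.1 h1.2.2 w
  have hG4 : ContDiff ℝ 4 G := hG.of_le (by exact_mod_cast (by omega : 4 ≤ M + 2))
  have he : (fun x => fderiv ℝ (fun x => fderiv ℝ G x v) x w) = fun x => fderiv ℝ (fderiv ℝ G) x v w := by
    funext x; rw [(Cb4.hasFDerivAt_partial hG4 v x).fderiv]
  rw [he] at h2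
  exact h2

end Helpers

/-! ### The entropy production formula for the smoothed class -/

section Entropy

variable (D : CovDecomposition N) {Ψ V₀ F : EuclideanSpace ℝ (Fin N) → ℝ} {B BF c₁ c₂ : ℝ}

set_option maxHeartbeats 4000000 in
/-- **Entropy production along the Polchinski flow, smoothed class** ([BBD] proof of Theorem 3, (e:dEnt),
p0016 L47–75, for initial data `e^{−V₀} = Ψ` with `Ψ ∈ C⁸` positive, bounded, `Ψ`-dominated derivatives and a
Gaussian lower bound — the class of `e^{−V_s}`, `s > 0`, when `V₀` is merely measurable and bounded below):
for `F ∈ C⁸(ℝ^N)` with bounded derivatives, `Φ ∈ C³(ℝ)` with `Φ, Φ′, Φ″, Φ‴` bounded, and `t > 0`,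
`d/ds|_{s=t} E_{ν_s}[Φ(P_{0,s}F)] = −E_{ν_t}[½ Φ″(P_{0,t}F) Σ_{ij} Ċ_t^{ij} ∂_iP_{0,t}F ∂_jP_{0,t}F]`.
No claim about Yang–Mills is made. [cite: BauerschmidtBodineauDagallier2023, Theorem 3 (proof, (e:dEnt))] -/
theorem hasDerivAt_renormExpect_comp_semigroup_smoothed
    (hΨ : ContDiff ℝ 8 Ψ) (hB : ∀ n ≤ 8, ∀ x, ‖iteratedFDeriv ℝ n Ψ x‖ ≤ B) (hpos : ∀ x, 0 < Ψ x)
    (hw : ∀ n ≤ 8, ∀ δ : ℝ, 0 < δ → ∃ c : ℝ, 0 ≤ c ∧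
      ∀ (P : Measure (EuclideanSpace ℝ (Fin N))) [IsProbabilityMeasure P] (y : EuclideanSpace ℝ (Fin N)),
        ∫ ζ, ‖iteratedFDeriv ℝ n Ψ (y + ζ)‖ ∂P ≤ c * (∫ ζ, Ψ (y + ζ) ∂P) ^ (1 - δ))
    (hc₁ : 0 < c₁) (hc₂ : 0 ≤ c₂) (hlow : ∀ x, c₁ * Real.exp (-(c₂ * ‖x‖ ^ 2)) ≤ Ψ x)
    (hΨV : ∀ x, Real.exp (-V₀ x) = Ψ x)
    (hF : ContDiff ℝ 8 F) (hFB : ∀ n ≤ 8, ∀ x, ‖iteratedFDeriv ℝ n F x‖ ≤ BF)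
    {Φ dΦ d2Φ d3Φ : ℝ → ℝ} (hΦ1 : ∀ x, HasDerivAt Φ (dΦ x) x) (hΦ2 : ∀ x, HasDerivAt dΦ (d2Φ x) x)
    (hΦ3 : ∀ x, HasDerivAt d2Φ (d3Φ x) x)
    {P0 P1 P2 P3 : ℝ} (hP0 : ∀ x, |Φ x| ≤ P0) (hP1 : ∀ x, |dΦ x| ≤ P1) (hP2 : ∀ x, |d2Φ x| ≤ P2)
    (hP3 : ∀ x, |d3Φ x| ≤ P3) {t : ℝ} (ht : 0 < t) :
    HasDerivAt (fun s => renormExpect D V₀ s fun y => Φ (semigroup D V₀ 0 s F y))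
      (-(renormExpect D V₀ t fun y => (1 / 2) * d2Φ (semigroup D V₀ 0 t F y) *
        ∑ i, ∑ j, D.Cdot t i j * (fderiv ℝ (semigroup D V₀ 0 t F) y (EuclideanSpace.single i 1) *
          fderiv ℝ (semigroup D V₀ 0 t F) y (EuclideanSpace.single j 1)))) t := by
  classical
  ---------------------------------------------------------------- the smoothed-class data
  obtain ⟨x0⟩ : Nonempty (EuclideanSpace ℝ (Fin N)) := ⟨0⟩
  have hΨ0 : ∀ x, 0 ≤ Ψ x := fun x => (hpos x).le
  have hΨ4 : ContDiff ℝ 4 Ψ := hΨ.of_le (by norm_num)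
  have hB4 : ∀ n ≤ 4, ∀ x, ‖iteratedFDeriv ℝ n Ψ x‖ ≤ B := fun n hn => hB n (by omega)
  have hw4 : ∀ n ≤ 4, ∀ δ : ℝ, 0 < δ → ∃ c : ℝ, 0 ≤ c ∧
      ∀ (P : Measure (EuclideanSpace ℝ (Fin N))) [IsProbabilityMeasure P] (y : EuclideanSpace ℝ (Fin N)),
        ∫ ζ, ‖iteratedFDeriv ℝ n Ψ (y + ζ)‖ ∂P ≤ c * (∫ ζ, Ψ (y + ζ) ∂P) ^ (1 - δ) :=
    fun n hn => hw n (by omega)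
  have hΨc : Continuous Ψ := hΨ4.continuous
  have hΨabs : ∀ x, |Ψ x| ≤ B := Cb4.abs_le hB4
  have hΨB : ∀ x, Ψ x ≤ B := fun x => (le_abs_self _).trans (hΨabs x)
  have hBpos : 0 < B := (hpos x0).trans_le (hΨB x0)
  -- `V₀ = −log Ψ`
  have hV0 : ∀ x, V₀ x = -Real.log (Ψ x) := fun x => by
    have h := congrArg Real.log (hΨV x)
    rw [Real.log_exp] at h
    linarith
  have hVm : Measurable V₀ := by
    have he : V₀ = fun x => -Real.log (Ψ x) := funext hV0
    rw [he]
    exact (Real.measurable_log.comp hΨc.measurable).neg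
  have hb : ∀ φ, -Real.log B ≤ V₀ φ := fun φ => by
    rw [hV0]
    exact neg_le_neg (Real.log_le_log (hpos φ) (hΨB φ))
  -- `F`
  have hF4 : ContDiff ℝ 4 F := hF.of_le (by norm_num)
  have hFB4 : ∀ n ≤ 4, ∀ x, ‖iteratedFDeriv ℝ n F x‖ ≤ BF := fun n hn => hFB n (by omega)
  have hFc : Continuous F := hF4.continuous
  have hFabs : ∀ x, |F x| ≤ BF := Cb4.abs_le hFB4
  have hBF0 : 0 ≤ BF := (abs_nonneg _).trans (hFabs x0)
  have hFab : ∀ x, -BF ≤ F x ∧ F x ≤ BF := fun x => abs_le.1 (hFabs x)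
  -- `ΨF` and the partials are `Ψ`-dominated
  obtain ⟨hΨF8, hBΨF8, hwΨF8⟩ := dominated_mul (M := 8) hΨ0 hΨ hB hw hF hFB
  have hΨF4 : ContDiff ℝ 4 (fun x => Ψ x * F x) := hΨF8.of_le (by norm_num)
  have hBΨF4 : ∀ n ≤ 4, ∀ x, ‖iteratedFDeriv ℝ n (fun x => Ψ x * F x) x‖ ≤ 2 ^ 8 * B * BF :=
    fun n hn => hBΨF8 n (by omega)
  have hwΨF4 : ∀ n ≤ 4, ∀ δ : ℝ, 0 < δ → ∃ c : ℝ, 0 ≤ c ∧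
      ∀ (P : Measure (EuclideanSpace ℝ (Fin N))) [IsProbabilityMeasure P] (y : EuclideanSpace ℝ (Fin N)),
        ∫ ζ, ‖iteratedFDeriv ℝ n (fun x => Ψ x * F x) (y + ζ)‖ ∂P ≤ c * (∫ ζ, Ψ (y + ζ) ∂P) ^ (1 - δ) :=
    fun n hn => hwΨF8 n (by omega)
  -- first partials
  have dZj := fun j : Fin N => dominated_partial (M := 7) (hΨ.of_le (by norm_num))
    (fun n hn => hB n (by omega)) (fun n hn => hw n (by omega)) (EuclideanSpace.single j 1)
  have dWj := fun j : Fin N => dominated_partial (M := 7) (hΨF8.of_le (by norm_num))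
    (fun n hn => hBΨF8 n (by omega)) (fun n hn => hwΨF8 n (by omega)) (EuclideanSpace.single j 1)
  -- second partials `x ↦ D²G(x)(e_a, e_b)` as partials of partials
  have dZab := fun a b : Fin N => dominated_partial (M := 6) ((dZj a).1.of_le (by norm_num))
    (fun n hn => (dZj a).2.1 n (by omega)) (fun n hn => (dZj a).2.2 n (by omega)) (EuclideanSpace.single b 1)
  have dWab := fun a b : Fin N => dominated_partial (M := 6) ((dWj a).1.of_le (by norm_num))
    (fun n hn => (dWj a).2.1 n (by omega)) (fun n hn => (dWj a).2.2 n (by omega)) (EuclideanSpace.single b 1)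
  have heZab : ∀ a b : Fin N, (fun x => fderiv ℝ (fun x => fderiv ℝ Ψ x (EuclideanSpace.single a 1)) x
      (EuclideanSpace.single b 1)) = fun x => fderiv ℝ (fderiv ℝ Ψ) x (EuclideanSpace.single a 1)
      (EuclideanSpace.single b 1) := fun a b => by
    funext x; rw [(Cb4.hasFDerivAt_partial hΨ4 (EuclideanSpace.single a 1) x).fderiv]
  have heWab : ∀ a b : Fin N, (fun x => fderiv ℝ (fun x => fderiv ℝ (fun x => Ψ x * F x) x
      (EuclideanSpace.single a 1)) x (EuclideanSpace.single b 1)) =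
      fun x => fderiv ℝ (fderiv ℝ (fun x => Ψ x * F x)) x (EuclideanSpace.single a 1)
      (EuclideanSpace.single b 1) := fun a b => by
    funext x; rw [(Cb4.hasFDerivAt_partial hΨF4 (EuclideanSpace.single a 1) x).fderiv]
  ---------------------------------------------------------------- atoms at scale `t`
  set P : ℝ → Measure (EuclideanSpace ℝ (Fin N)) := fun s => multivariateGaussian 0 (D.C s) with hP_def
  haveI : ∀ s, IsProbabilityMeasure (P s) := fun s => by rw [hP_def]; infer_instance
  have hZpos : ∀ s y, 0 < ∫ ζ, Ψ (y + ζ) ∂(P s) := fun s y => smZ_pos hΨc hpos hΨB (P s) y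
  have hZle : ∀ s y, ∫ ζ, Ψ (y + ζ) ∂(P s) ≤ B := fun s y => smZ_le hΨc hpos hΨB (P s) y
  have hWmem := fun s y => smW_mem hΨc hpos hΨB hFc hFab (P s) y
  have hsemi : ∀ s y, semigroup D V₀ 0 s F y =
      (∫ ζ, Ψ (y + ζ) * F (y + ζ) ∂(P s)) * (∫ ζ, Ψ (y + ζ) ∂(P s))⁻¹ := fun s y => by
    rw [semigroup_zero_eq, exp_renormPotential_eq_inv D hVm hb, mul_comm]
    simp only [hΨV, hP_def]
  have hub : ∀ s y, |(∫ ζ, Ψ (y + ζ) * F (y + ζ) ∂(P s)) * (∫ ζ, Ψ (y + ζ) ∂(P s))⁻¹| ≤ BF := by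
    intro s y
    rw [← div_eq_mul_inv, abs_div, abs_of_pos (hZpos s y), div_le_iff₀ (hZpos s y), abs_le]
    constructor
    · have := (hWmem s y).1; linarith
    · exact (hWmem s y).2
  ---------------------------------------------------------------- jet packs at scale `t`
  have dZab := fun a b : Fin N => dominated_partial₂ (M := 6) (by norm_num) (Ψ := Ψ)
    (hΨ.of_le (by norm_num)) (fun n hn => hB n (by omega)) (fun n hn => hw n (by omega))
    (EuclideanSpace.single a 1) (EuclideanSpace.single b 1)
  have dWab := fun a b : Fin N => dominated_partial₂ (M := 6) (by norm_num) (Ψ := Ψ)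
    (hΨF8.of_le (by norm_num)) (fun n hn => hBΨF8 n (by omega)) (fun n hn => hwΨF8 n (by omega))
    (EuclideanSpace.single a 1) (EuclideanSpace.single b 1)
  have hZ : ∀ y, 0 < ∫ ζ, Ψ (y + ζ) ∂(P t) := hZpos t
  have hZK : ∀ y, ∫ ζ, Ψ (y + ζ) ∂(P t) ≤ B := hZle t
  have pZ := sm_jpack (Ψ := Ψ) hΨ4 hB4 (P t) hw4
  have pW := sm_jpack (Ψ := Ψ) hΨF4 hBΨF4 (P t) hwΨF4
  have pZj := fun j : Fin N => sm_jpack (Ψ := Ψ) ((dZj j).1.of_le (by norm_num))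
    (fun n hn => (dZj j).2.1 n (by omega)) (P t) (fun n hn => (dZj j).2.2 n (by omega))
  have pWj := fun j : Fin N => sm_jpack (Ψ := Ψ) ((dWj j).1.of_le (by norm_num))
    (fun n hn => (dWj j).2.1 n (by omega)) (P t) (fun n hn => (dWj j).2.2 n (by omega))
  have pZab := fun a b : Fin N => sm_jpack (Ψ := Ψ) ((dZab a b).1.of_le (by norm_num))
    (fun n hn => (dZab a b).2.1 n (by omega)) (P t) (fun n hn => (dZab a b).2.2 n (by omega))
  have pWab := fun a b : Fin N => sm_jpack (Ψ := Ψ) ((dWab a b).1.of_le (by norm_num))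
    (fun n hn => (dWab a b).2.1 n (by omega)) (P t) (fun n hn => (dWab a b).2.2 n (by omega))
  -- basis evaluations of the first jets
  have hZ1 : ∀ (j : Fin N) y, (∫ ζ, fderiv ℝ Ψ (y + ζ) ∂(P t)) (EuclideanSpace.single j 1) =
      ∫ ζ, fderiv ℝ Ψ (y + ζ) (EuclideanSpace.single j 1) ∂(P t) :=
    fun j y => sm_fderiv_apply hΨ4 hB4 (P t) y _
  have hW1 : ∀ (j : Fin N) y, (∫ ζ, fderiv ℝ (fun x => Ψ x * F x) (y + ζ) ∂(P t))
      (EuclideanSpace.single j 1) =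
      ∫ ζ, fderiv ℝ (fun x => Ψ x * F x) (y + ζ) (EuclideanSpace.single j 1) ∂(P t) :=
    fun j y => sm_fderiv_apply hΨF4 hBΨF4 (P t) y _
  ---------------------------------------------------------------- `u = W/Z`, `g_j = ∂_j u`, `Φ∘u`, `Φ′∘u`
  set u : EuclideanSpace ℝ (Fin N) → ℝ := fun y =>
    (∫ ζ, Ψ (y + ζ) * F (y + ζ) ∂(P t)) * (∫ ζ, Ψ (y + ζ) ∂(P t))⁻¹ with hu_def
  obtain ⟨Du, D2u, pu, hDu, hD2u⟩ := quotient_tjets hZ pZ pW u (fun y => rfl)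
  set g : Fin N → EuclideanSpace ℝ (Fin N) → ℝ := fun j y =>
    (∫ ζ, fderiv ℝ (fun x => Ψ x * F x) (y + ζ) (EuclideanSpace.single j 1) ∂(P t)) *
        (∫ ζ, Ψ (y + ζ) ∂(P t))⁻¹ -
      (∫ ζ, Ψ (y + ζ) * F (y + ζ) ∂(P t)) * (∫ ζ, Ψ (y + ζ) ∂(P t))⁻¹ *
        ((∫ ζ, fderiv ℝ Ψ (y + ζ) (EuclideanSpace.single j 1) ∂(P t)) * (∫ ζ, Ψ (y + ζ) ∂(P t))⁻¹)
    with hg_def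
  have hgj := fun j : Fin N => gradQuotient_tjets hZ pZ pW (pZj j) (pWj j) (g j) (fun y => rfl)
  choose Dg D2g pg hDg hD2g using hgj
  have hgDu : ∀ j y, Du y (EuclideanSpace.single j 1) = g j y := fun j y => by
    have hZne : (∫ ζ, Ψ (y + ζ) ∂(P t)) ≠ 0 := (hZ y).ne'
    rw [hDu, hZ1, hW1, hg_def]
    field_simp
  have hP00 : 0 ≤ P0 := (abs_nonneg _).trans (hP0 0)
  have hP10 : 0 ≤ P1 := (abs_nonneg _).trans (hP1 0)
  have hP20 : 0 ≤ P2 := (abs_nonneg _).trans (hP2 0)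
  have pΦu := tpack_comp hZ hZK pu hΦ1 hΦ2 hP0 hP1 hP2
  have pΦ'u := tpack_comp hZ hZK pu hΦ2 hΦ3 hP1 hP2 hP3
  ---------------------------------------------------------------- the weighted family `K_s = Z_s Φ(u_s)`
  set K : ℝ → EuclideanSpace ℝ (Fin N) → ℝ := fun s y =>
    (∫ ζ, Ψ (y + ζ) ∂(P s)) * Φ ((∫ ζ, Ψ (y + ζ) * F (y + ζ) ∂(P s)) * (∫ ζ, Ψ (y + ζ) ∂(P s))⁻¹)
    with hK_def
  have pK := jpack_mul_tpack hZ pZ pΦu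
  have hKt : K t = fun y => (∫ ζ, Ψ (y + ζ) ∂(P t)) * Φ (u y) := by
    funext y; simp only [hK_def, hu_def]
  -- `∂_j K_t = Z_j Φ(u) + Z Φ′(u) g_j`
  have pKj := fun j : Fin N => jpack_add (jpack_mul_tpack hZ (pZj j) pΦu)
    (jpack_mul_tpack hZ pZ (tpack_mul hZ pΦ'u (pg j)))
  have hKj : ∀ (j : Fin N) y,
      ((∫ ζ, Ψ (y + ζ) ∂(P t)) • (dΦ (u y) • Du y) + Φ (u y) • ∫ ζ, fderiv ℝ Ψ (y + ζ) ∂(P t))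
        (EuclideanSpace.single j 1) =
      (∫ ζ, fderiv ℝ Ψ (y + ζ) (EuclideanSpace.single j 1) ∂(P t)) * Φ (u y) +
        (∫ ζ, Ψ (y + ζ) ∂(P t)) * (dΦ (u y) * g j y) := by
    intro j y
    simp only [_root_.add_apply, _root_.smul_apply, smul_eq_mul, hZ1, hgDu]
    ring
  have hUCK := uniformContinuous_of_partial_packs pK.2.1 hKj (fun j => (pKj j).1)
    (fun j => (pKj j).2.1) (fun j => by
      obtain ⟨L, -, hL⟩ := bounded_of_jet (pKj j).2.2.2.2
      exact ⟨L, hL⟩) pK.1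
  obtain ⟨MK, -, hMK⟩ := bounded_of_jet pK.2.2.2.2
  -- continuity and the uniform bound of `K_s`
  have hKc : ∀ s, Continuous (K s) := by
    intro s
    have cZ : Continuous fun y => ∫ ζ, Ψ (y + ζ) ∂(P s) :=
      continuous_iff_continuousAt.2 fun y => (sm_hasFDerivAt hΨ4 hB4 (P s) y).continuousAt
    have cW : Continuous fun y => ∫ ζ, Ψ (y + ζ) * F (y + ζ) ∂(P s) :=
      continuous_iff_continuousAt.2 fun y => (sm_hasFDerivAt hΨF4 hBΨF4 (P s) y).continuousAt
    have hΦc : Continuous Φ := continuous_iff_continuousAt.2 fun x => (hΦ1 x).continuousAt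
    exact cZ.mul (hΦc.comp (cW.mul (cZ.inv₀ fun y => (hZpos s y).ne')))
  have hKb : ∀ s y, |K s y| ≤ B * P0 := fun s y => by
    simp only [hK_def]
    rw [abs_mul, abs_of_pos (hZpos s y)]
    exact mul_le_mul (hZle s y) (hP0 _) (abs_nonneg _) hBpos.le
  ---------------------------------------------------------------- the slope `K̇ = Ż Φ(u) + (Ẇ − u Ż) Φ′(u)`
  set Zd : EuclideanSpace ℝ (Fin N) → ℝ := fun y => (1 / 2) * ∑ a, ∑ b, D.Cdot t a b *
    ∫ ζ, fderiv ℝ (fderiv ℝ Ψ) (y + ζ) (EuclideanSpace.single a 1) (EuclideanSpace.single b 1) ∂(P t)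
    with hZd_def
  set Wd : EuclideanSpace ℝ (Fin N) → ℝ := fun y => (1 / 2) * ∑ a, ∑ b, D.Cdot t a b *
    ∫ ζ, fderiv ℝ (fderiv ℝ (fun x => Ψ x * F x)) (y + ζ) (EuclideanSpace.single a 1)
      (EuclideanSpace.single b 1) ∂(P t) with hWd_def
  have pZd := jpack_const_mul (1 / 2 : ℝ) (jpack_sum Finset.univ fun a _ =>
    jpack_sum Finset.univ fun b _ => jpack_const_mul (D.Cdot t a b) (pZab a b))
  have pWd := jpack_const_mul (1 / 2 : ℝ) (jpack_sum Finset.univ fun a _ =>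
    jpack_sum Finset.univ fun b _ => jpack_const_mul (D.Cdot t a b) (pWab a b))
  set Kd : EuclideanSpace ℝ (Fin N) → ℝ := fun y =>
    Zd y * Φ (u y) + (Wd y + (-1) * (Zd y * u y)) * dΦ (u y) with hKd_def
  have pKd := jpack_add (jpack_mul_tpack hZ pZd pΦu)
    (jpack_mul_tpack hZ (jpack_add pWd (jpack_const_mul (-1 : ℝ) (jpack_mul_tpack hZ pZd pu))) pΦ'u)
  have hKdc : Continuous Kd := continuous_iff_continuousAt.2 fun y => (pKd.1 y).continuousAt
  obtain ⟨Kd0, -, hKdb⟩ := bounded_of_jet pKd.2.2.1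
  obtain ⟨Kd1, -, hKd1⟩ := bounded_of_jet pKd.2.2.2.1
  have hKduc : UniformContinuous Kd := uc_of_hasFDerivAt_bound pKd.1 hKd1
  ---------------------------------------------------------------- Lipschitz facts for `Φ`, `Φ′`
  have hLipΦ : ∀ x y, |Φ x - Φ y| ≤ P1 * |x - y| := by
    intro x y
    rw [← Real.norm_eq_abs, ← Real.norm_eq_abs (x - y)]
    exact Convex.norm_image_sub_le_of_norm_hasDerivWithin_le (𝕜 := ℝ) (s := univ)
      (fun z _ => (hΦ1 z).hasDerivWithinAt) (fun z _ => by rw [Real.norm_eq_abs]; exact hP1 z)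
      convex_univ (mem_univ y) (mem_univ x)
  have hLipΦ' : ∀ x y, |dΦ x - dΦ y| ≤ P2 * |x - y| := by
    intro x y
    rw [← Real.norm_eq_abs, ← Real.norm_eq_abs (x - y)]
    exact Convex.norm_image_sub_le_of_norm_hasDerivWithin_le (𝕜 := ℝ) (s := univ)
      (fun z _ => (hΦ2 z).hasDerivWithinAt) (fun z _ => by rw [Real.norm_eq_abs]; exact hP2 z)
      convex_univ (mem_univ y) (mem_univ x)
  ---------------------------------------------------------------- the tempered slope of `K`
  obtain ⟨KZd, hKZd0, hKZd⟩ := bounded_of_jet pZd.2.2.1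
  obtain ⟨KWd, hKWd0, hKWd⟩ := bounded_of_jet pWd.2.2.1
  -- uniform slopes of the atoms `Z_s`, `W_s` at `s = t` (Prop 5)
  have sZ : ∀ ε : ℝ, 0 < ε → ∀ᶠ s in 𝓝 t, ∀ y : EuclideanSpace ℝ (Fin N),
      |(∫ ζ, Ψ (y + ζ) ∂(P s)) - (∫ ζ, Ψ (y + ζ) ∂(P t)) - (s - t) * Zd y| ≤ ε * |s - t| :=
    fun ε hε => sm_uniformSlope D hΨ4 hB4 ht ε hε
  have sW : ∀ ε : ℝ, 0 < ε → ∀ᶠ s in 𝓝 t, ∀ y : EuclideanSpace ℝ (Fin N),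
      |(∫ ζ, Ψ (y + ζ) * F (y + ζ) ∂(P s)) - (∫ ζ, Ψ (y + ζ) * F (y + ζ) ∂(P t)) - (s - t) * Wd y| ≤
        ε * |s - t| :=
    fun ε hε => sm_uniformSlope D hΨF4 hBΨF4 ht ε hε
  -- Gaussian lower bound of `Z_t`
  have hc₂' : 0 < c₂ + 1 := by linarith
  have hlow' : ∀ x, c₁ * Real.exp (-((c₂ + 1) * ‖x‖ ^ 2)) ≤ Ψ x := fun x =>
    le_trans (mul_le_mul_of_nonneg_left (Real.exp_le_exp.2 (by nlinarith [sq_nonneg ‖x‖])) hc₁.le)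
      (hlow x)
  obtain ⟨m, hm, hmZ⟩ := exists_mul_exp_neg_le_atom hΨc hΨabs hc₁ hc₂'.le hlow' (P t)
  have hU : ∀ a : ℝ, 0 < a → ∀ ε : ℝ, 0 < ε → ∀ᶠ s in 𝓝 t, ∀ y : EuclideanSpace ℝ (Fin N),
      |K s y - K t y - (s - t) * Kd y| ≤ ε * |s - t| * Real.exp (a * ‖y‖ ^ 2) := by
    intro a ha ε hε
    -- constants
    set LZ : ℝ := KZd + 1 with hLZ
    set LW : ℝ := KWd + 1 with hLW
    set LΔ : ℝ := LW + BF * LZ with hLΔ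
    have hLZ0 : 0 < LZ := by positivity
    have hLΔ0 : 0 ≤ LΔ := by positivity
    set C₀ : ℝ := P0 + 2 * P1 * LΔ + P1 * (1 + BF) with hC₀
    have hC₀0 : 0 ≤ C₀ := by positivity
    set R : ℝ := Real.log (C₀ / ε + 1) / a with hR
    set η : ℝ := m * Real.exp (-(2 * (c₂ + 1) * R)) with hη
    have hη0 : 0 < η := by positivity
    set ε' : ℝ := ε / (3 * (P0 + P1 * (1 + BF)) + 3) with hε'
    have hden : 0 < 3 * (P0 + P1 * (1 + BF)) + 3 := by positivity
    have hε'0 : 0 < ε' := by positivity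
    have hε'le : ε' * (P0 + P1 * (1 + BF)) ≤ ε / 3 := by
      rw [hε', div_mul_eq_mul_div, div_le_div_iff₀ hden (by norm_num)]
      nlinarith [hP00, hP10, hBF0]
    -- eventually: the four slope facts and two smallness conditions on `|s − t|`
    have ev5 : ∀ᶠ s in 𝓝 t, |s - t| < η / (2 * LZ) := by
      have h0 : Tendsto (fun s : ℝ => |s - t|) (𝓝 t) (𝓝 0) := by
        have h := (tendsto_id.sub_const t : Tendsto (fun s : ℝ => s - t) (𝓝 t) (𝓝 (t - t)))
        rw [sub_self] at h
        simpa using h.abs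
      exact (tendsto_order.1 h0).2 _ (by positivity)
    have ev6 : ∀ᶠ s in 𝓝 t, |s - t| < ε * η / (6 * P2 * LΔ ^ 2 + 1) := by
      have h0 : Tendsto (fun s : ℝ => |s - t|) (𝓝 t) (𝓝 0) := by
        have h := (tendsto_id.sub_const t : Tendsto (fun s : ℝ => s - t) (𝓝 t) (𝓝 (t - t)))
        rw [sub_self] at h
        simpa using h.abs
      exact (tendsto_order.1 h0).2 _ (by positivity)
    filter_upwards [sZ 1 one_pos, sW 1 one_pos, sZ ε' hε'0, sW ε' hε'0, ev5, ev6]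
      with s hZ1' hW1' hZε hWε h5 h6 y
    -- abbreviations at the point `y`
    set Zs : ℝ := ∫ ζ, Ψ (y + ζ) ∂(P s) with hZs
    set Zt : ℝ := ∫ ζ, Ψ (y + ζ) ∂(P t) with hZt
    set Ws : ℝ := ∫ ζ, Ψ (y + ζ) * F (y + ζ) ∂(P s) with hWs
    set Wt : ℝ := ∫ ζ, Ψ (y + ζ) * F (y + ζ) ∂(P t) with hWt
    have hZs0 : 0 < Zs := hZpos s y
    have hZt0 : 0 < Zt := hZpos t y
    set us : ℝ := Ws * Zs⁻¹ with hus
    set ut : ℝ := Wt * Zt⁻¹ with hut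
    have hutb : |ut| ≤ BF := hub t y
    have hZsne : Zs ≠ 0 := hZs0.ne'
    have hZtne : Zt ≠ 0 := hZt0.ne'
    -- the three pieces
    set SZ : ℝ := Zs - Zt - (s - t) * Zd y with hSZ
    set SW : ℝ := Ws - Wt - (s - t) * Wd y with hSW
    set Δ : ℝ := (Ws - Wt) - ut * (Zs - Zt) with hΔ
    set Rem : ℝ := Φ us - Φ ut - dΦ ut * (us - ut) with hRem
    set R1 : ℝ := SW - ut * SZ with hR1
    have hKs : K s y = Zs * Φ (Ws * Zs⁻¹) := rfl
    have hKt' : K t y = Zt * Φ (Wt * Zt⁻¹) := rfl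
    have hKd' : Kd y = Zd y * Φ (Wt * Zt⁻¹) + (Wd y + (-1) * (Zd y * (Wt * Zt⁻¹))) * dΦ (Wt * Zt⁻¹) := rfl
    have hident : K s y - K t y - (s - t) * Kd y = SZ * Φ ut + Zs * Rem + dΦ ut * R1 := by
      rw [hKs, hKt', hKd']
      simp only [hSZ, hSW, hRem, hR1, hus, hut]
      field_simp
      ring
    have hΔeq : Zs * (us - ut) = Δ := by
      simp only [hus, hut, hΔ]
      field_simp
      ring
    -- sizes of the pieces
    have bSZ1 : |SZ| ≤ 1 * |s - t| := hZ1' y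
    have bSW1 : |SW| ≤ 1 * |s - t| := hW1' y
    have bSZ : |SZ| ≤ ε' * |s - t| := hZε y
    have bSW : |SW| ≤ ε' * |s - t| := hWε y
    have bdZ : |Zs - Zt| ≤ LZ * |s - t| := by
      have h : Zs - Zt = SZ + (s - t) * Zd y := by simp only [hSZ]; ring
      rw [h]
      calc |SZ + (s - t) * Zd y| ≤ |SZ| + |(s - t) * Zd y| := abs_add_le _ _
        _ ≤ 1 * |s - t| + |s - t| * KZd := by
            rw [abs_mul]; exact add_le_add bSZ1 (mul_le_mul_of_nonneg_left (hKZd y) (abs_nonneg _))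
        _ = LZ * |s - t| := by rw [hLZ]; ring
    have bdW : |Ws - Wt| ≤ LW * |s - t| := by
      have h : Ws - Wt = SW + (s - t) * Wd y := by simp only [hSW]; ring
      rw [h]
      calc |SW + (s - t) * Wd y| ≤ |SW| + |(s - t) * Wd y| := abs_add_le _ _
        _ ≤ 1 * |s - t| + |s - t| * KWd := by
            rw [abs_mul]; exact add_le_add bSW1 (mul_le_mul_of_nonneg_left (hKWd y) (abs_nonneg _))
        _ = LW * |s - t| := by rw [hLW]; ring
    have bΔ : |Δ| ≤ LΔ * |s - t| := by
      calc |Δ| ≤ |Ws - Wt| + |ut * (Zs - Zt)| := abs_sub _ _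
        _ ≤ LW * |s - t| + BF * (LZ * |s - t|) := by
            rw [abs_mul]; exact add_le_add bdW (mul_le_mul hutb bdZ (abs_nonneg _) hBF0)
        _ = LΔ * |s - t| := by rw [hLΔ]; ring
    have bR1 : |R1| ≤ (1 + BF) * (ε' * |s - t|) := by
      calc |R1| ≤ |SW| + |ut * SZ| := abs_sub _ _
        _ ≤ ε' * |s - t| + BF * (ε' * |s - t|) := by
            rw [abs_mul]; exact add_le_add bSW (mul_le_mul hutb bSZ (abs_nonneg _) hBF0)
        _ = (1 + BF) * (ε' * |s - t|) := by ring
    have bR1' : |R1| ≤ (1 + BF) * |s - t| := by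
      calc |R1| ≤ |SW| + |ut * SZ| := abs_sub _ _
        _ ≤ 1 * |s - t| + BF * (1 * |s - t|) := by
            rw [abs_mul]; exact add_le_add bSW1 (mul_le_mul hutb bSZ1 (abs_nonneg _) hBF0)
        _ = (1 + BF) * |s - t| := by ring
    -- the Taylor remainder, weighted: crude bound `Z_s|Rem| ≤ 2P₁|Δ|`, fine bound `≤ P₂|Δ||u_s − u_t|`
    have bRem_crude : Zs * |Rem| ≤ 2 * P1 * (LΔ * |s - t|) := by
      have h1 : |Φ us - Φ ut| ≤ P1 * |us - ut| := hLipΦ us ut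
      have h2 : |Rem| ≤ 2 * P1 * |us - ut| := by
        calc |Rem| ≤ |Φ us - Φ ut| + |dΦ ut * (us - ut)| := abs_sub _ _
          _ ≤ P1 * |us - ut| + P1 * |us - ut| := by
              rw [abs_mul]; exact add_le_add h1 (mul_le_mul_of_nonneg_right (hP1 _) (abs_nonneg _))
          _ = 2 * P1 * |us - ut| := by ring
      calc Zs * |Rem| ≤ Zs * (2 * P1 * |us - ut|) := mul_le_mul_of_nonneg_left h2 hZs0.le
        _ = 2 * P1 * |Zs * (us - ut)| := by rw [abs_mul, abs_of_pos hZs0]; ring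
        _ = 2 * P1 * |Δ| := by rw [hΔeq]
        _ ≤ 2 * P1 * (LΔ * |s - t|) := mul_le_mul_of_nonneg_left bΔ (by positivity)
    have bRem_fine : Zs * |Rem| ≤ P2 * |Δ| * |us - ut| := by
      have h := abs_taylor₂_le hΦ1 hP20 hLipΦ' ut us
      calc Zs * |Rem| ≤ Zs * (P2 * (us - ut) ^ 2) := mul_le_mul_of_nonneg_left h hZs0.le
        _ = P2 * |Zs * (us - ut)| * |us - ut| := by
            rw [abs_mul, abs_of_pos hZs0, ← sq_abs (us - ut)]; ring
        _ = P2 * |Δ| * |us - ut| := by rw [hΔeq]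
    have hexp1 : 1 ≤ Real.exp (a * ‖y‖ ^ 2) := Real.one_le_exp (by positivity)
    rw [hident]
    by_cases hcase : η ≤ Zt
    · ---------------------------------------------------------------- Case 1: `Z_t(y) ≥ η`
      have hZs_low : η / 2 ≤ Zs := by
        have h1 : |Zs - Zt| ≤ LZ * |s - t| := bdZ
        have h2 : LZ * |s - t| ≤ η / 2 := by
          have := (mul_lt_mul_of_pos_left h5 hLZ0).le
          calc LZ * |s - t| ≤ LZ * (η / (2 * LZ)) := this
            _ = η / 2 := by field_simp
        have h3 : Zt - LZ * |s - t| ≤ Zs := by linarith [(abs_le.1 h1).1]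
        linarith
      have hδu : |us - ut| ≤ 2 * (LΔ * |s - t|) / η := by
        have h : |us - ut| = |Δ| / Zs := by
          rw [← hΔeq, abs_mul, abs_of_pos hZs0, mul_div_cancel_left₀ _ hZs0.ne']
        rw [h, div_le_div_iff₀ hZs0 hη0]
        calc |Δ| * η ≤ (LΔ * |s - t|) * η := mul_le_mul_of_nonneg_right bΔ hη0.le
          _ = 2 * (LΔ * |s - t|) * (η / 2) := by ring
          _ ≤ 2 * (LΔ * |s - t|) * Zs := mul_le_mul_of_nonneg_left hZs_low (by positivity)
      have bZRem : Zs * |Rem| ≤ ε / 3 * |s - t| := by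
        have h1 : Zs * |Rem| ≤ (2 * P2 * LΔ ^ 2 / η) * |s - t| * |s - t| := by
          calc Zs * |Rem| ≤ P2 * |Δ| * |us - ut| := bRem_fine
            _ ≤ P2 * (LΔ * |s - t|) * (2 * (LΔ * |s - t|) / η) :=
                mul_le_mul (mul_le_mul_of_nonneg_left bΔ hP20) hδu (abs_nonneg _) (by positivity)
            _ = (2 * P2 * LΔ ^ 2 / η) * |s - t| * |s - t| := by ring
        have h2 : (2 * P2 * LΔ ^ 2 / η) * |s - t| ≤ ε / 3 := by
          have h6' : |s - t| ≤ ε * η / (6 * P2 * LΔ ^ 2 + 1) := h6.le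
          calc (2 * P2 * LΔ ^ 2 / η) * |s - t| ≤ (2 * P2 * LΔ ^ 2 / η) * (ε * η / (6 * P2 * LΔ ^ 2 + 1)) :=
                mul_le_mul_of_nonneg_left h6' (by positivity)
            _ = ε * (2 * P2 * LΔ ^ 2 / (6 * P2 * LΔ ^ 2 + 1)) := by field_simp
            _ ≤ ε * (1 / 3) := by
                refine mul_le_mul_of_nonneg_left ?_ hε.le
                rw [div_le_div_iff₀ (by positivity) (by norm_num)]
                nlinarith [mul_nonneg hP20 (sq_nonneg LΔ)]
            _ = ε / 3 := by ring
        calc Zs * |Rem| ≤ (2 * P2 * LΔ ^ 2 / η) * |s - t| * |s - t| := h1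
          _ ≤ ε / 3 * |s - t| := mul_le_mul_of_nonneg_right h2 (abs_nonneg _)
      calc |SZ * Φ ut + Zs * Rem + dΦ ut * R1|
          ≤ |SZ * Φ ut| + |Zs * Rem| + |dΦ ut * R1| := abs_add_three _ _ _
        _ ≤ ε' * |s - t| * P0 + ε / 3 * |s - t| + P1 * ((1 + BF) * (ε' * |s - t|)) := by
            refine add_le_add (add_le_add ?_ ?_) ?_
            · rw [abs_mul]; exact mul_le_mul bSZ (hP0 _) (abs_nonneg _) (by positivity)
            · rw [abs_mul, abs_of_pos hZs0]; exact bZRem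
            · rw [abs_mul]; exact mul_le_mul (hP1 _) bR1 (abs_nonneg _) hP10
        _ = (ε' * (P0 + P1 * (1 + BF)) + ε / 3) * |s - t| := by ring
        _ ≤ (ε / 3 + ε / 3) * |s - t| := mul_le_mul_of_nonneg_right (by linarith) (abs_nonneg _)
        _ ≤ ε * |s - t| * 1 := by rw [mul_one]; exact mul_le_mul_of_nonneg_right (by linarith) (abs_nonneg _)
        _ ≤ ε * |s - t| * Real.exp (a * ‖y‖ ^ 2) := mul_le_mul_of_nonneg_left hexp1 (by positivity)
    · ---------------------------------------------------------------- Case 2: `Z_t(y) < η`: `y` is far out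
      push Not at hcase
      have hfar : C₀ ≤ ε * Real.exp (a * ‖y‖ ^ 2) := by
        have h1 : m * Real.exp (-(2 * (c₂ + 1) * ‖y‖ ^ 2)) < m * Real.exp (-(2 * (c₂ + 1) * R)) :=
          (hmZ y).trans_lt hcase
        have h2 : Real.exp (-(2 * (c₂ + 1) * ‖y‖ ^ 2)) < Real.exp (-(2 * (c₂ + 1) * R)) :=
          lt_of_mul_lt_mul_left h1 hm.le
        rw [Real.exp_lt_exp] at h2
        have h3 : R < ‖y‖ ^ 2 := by nlinarith
        have h4 : Real.log (C₀ / ε + 1) < a * ‖y‖ ^ 2 := by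
          have : Real.log (C₀ / ε + 1) = a * R := by rw [hR]; field_simp
          rw [this]; exact mul_lt_mul_of_pos_left h3 ha
        have h5 : C₀ / ε + 1 < Real.exp (a * ‖y‖ ^ 2) := by
          calc C₀ / ε + 1 = Real.exp (Real.log (C₀ / ε + 1)) := (Real.exp_log (by positivity)).symm
            _ < Real.exp (a * ‖y‖ ^ 2) := Real.exp_lt_exp.2 h4
        have h6 : C₀ / ε ≤ Real.exp (a * ‖y‖ ^ 2) := by linarith
        rwa [div_le_iff₀ hε, mul_comm] at h6
      calc |SZ * Φ ut + Zs * Rem + dΦ ut * R1|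
          ≤ |SZ * Φ ut| + |Zs * Rem| + |dΦ ut * R1| := abs_add_three _ _ _
        _ ≤ 1 * |s - t| * P0 + 2 * P1 * (LΔ * |s - t|) + P1 * ((1 + BF) * |s - t|) := by
            refine add_le_add (add_le_add ?_ ?_) ?_
            · rw [abs_mul]; exact mul_le_mul bSZ1 (hP0 _) (abs_nonneg _) (by positivity)
            · rw [abs_mul, abs_of_pos hZs0]; exact bRem_crude
            · rw [abs_mul]; exact mul_le_mul (hP1 _) bR1' (abs_nonneg _) hP10
        _ = C₀ * |s - t| := by rw [hC₀]; ring
        _ ≤ ε * Real.exp (a * ‖y‖ ^ 2) * |s - t| := mul_le_mul_of_nonneg_right hfar (abs_nonneg _)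
        _ = ε * |s - t| * Real.exp (a * ‖y‖ ^ 2) := by ring
  ---------------------------------------------------------------- the tempered family rule at `φ = 0`
  have h1K : ∀ y, HasFDerivAt (K t)
      ((∫ ζ, Ψ (y + ζ) ∂(P t)) • (dΦ (u y) • Du y) + Φ (u y) • ∫ ζ, fderiv ℝ Ψ (y + ζ) ∂(P t)) y := by
    rw [hKt]; exact pK.1
  have hder := hasDerivAt_integral_family_Cinf_sub_of_sqExp D K Kd ht h1K pK.2.1 hKc hKb hMK hUCK
    hKdc hKdb hKduc hU 0
  simp only [zero_add] at hder
  have hB' := hder.const_mul (Real.exp (renormPotentialInf D V₀ 0))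
  ---------------------------------------------------------------- the left-hand side is `E_{ν_s}[Φ(P_{0,s}F)]`
  have hLHS : (fun s => renormExpect D V₀ s fun y => Φ (semigroup D V₀ 0 s F y)) =
      fun s => Real.exp (renormPotentialInf D V₀ 0) *
        ∫ x, K s x ∂(multivariateGaussian 0 (D.Cinf - D.C s)) := by
    funext s
    unfold renormExpect
    congr 1
    refine integral_congr_ae (Eventually.of_forall fun x => ?_)
    simp only [hK_def]
    rw [exp_neg_renormPotential D hVm hb, hsemi]
    simp only [hΨV, hP_def]
  rw [hLHS]
  refine hB'.congr_deriv ?_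
  ---------------------------------------------------------------- the right-hand side
  have hsemi_t : semigroup D V₀ 0 t F = u := funext fun y => hsemi t y
  have hfd : ∀ y, fderiv ℝ u y = Du y := fun y => (pu.1 y).fderiv
  rw [hsemi_t]
  simp only [hfd, hgDu]
  -- abbreviations
  set Q : Measure (EuclideanSpace ℝ (Fin N)) := multivariateGaussian 0 (D.Cinf - D.C t) with hQ_def
  set D2K : EuclideanSpace ℝ (Fin N) → EuclideanSpace ℝ (Fin N) →L[ℝ] EuclideanSpace ℝ (Fin N) →L[ℝ] ℝ :=
    fun x => (∫ ζ, Ψ (x + ζ) ∂(P t)) • (dΦ (u x) • D2u x + (d2Φ (u x) • Du x).smulRight (Du x)) +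
      (∫ ζ, fderiv ℝ Ψ (x + ζ) ∂(P t)).smulRight (dΦ (u x) • Du x) +
      (Φ (u x) • (∫ ζ, fderiv ℝ (fderiv ℝ Ψ) (x + ζ) ∂(P t)) +
        (dΦ (u x) • Du x).smulRight (∫ ζ, fderiv ℝ Ψ (x + ζ) ∂(P t))) with hD2K_def
  set G' : EuclideanSpace ℝ (Fin N) → ℝ := fun x => (1 / 2) * d2Φ (u x) *
    ∑ i, ∑ j, D.Cdot t i j * (g i x * g j x) with hG'_def
  -- the right-hand integrand is `Z_t G'`
  have hR : ∫ x, Real.exp (-renormPotential D V₀ t x) * G' x ∂Q =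
      ∫ x, (∫ ζ, Ψ (x + ζ) ∂(P t)) * G' x ∂Q := by
    refine integral_congr_ae (Eventually.of_forall fun x => ?_)
    show Real.exp (-renormPotential D V₀ t x) * G' x = (∫ ζ, Ψ (x + ζ) ∂(P t)) * G' x
    rw [exp_neg_renormPotential D hVm hb]
    simp only [hΨV, hP_def]
  -- integrability of the pieces
  have hD2Kc : Continuous D2K := hUCK.continuous
  have cD2Kij : ∀ i j : Fin N, Continuous fun x =>
      D2K x (EuclideanSpace.single i 1) (EuclideanSpace.single j 1) := fun i j =>
    ((ContinuousLinearMap.apply ℝ ℝ (EuclideanSpace.single j 1)).comp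
      (ContinuousLinearMap.apply ℝ (EuclideanSpace ℝ (Fin N) →L[ℝ] ℝ)
        (EuclideanSpace.single i 1))).continuous.comp hD2Kc
  have bD2Kij : ∀ (i j : Fin N) x,
      ‖D2K x (EuclideanSpace.single i 1) (EuclideanSpace.single j 1)‖ ≤ MK := fun i j x => by
    refine (ContinuousLinearMap.le_opNorm _ _).trans ?_
    rw [Cb4.norm_single_one, mul_one]
    refine (ContinuousLinearMap.le_opNorm _ _).trans ?_
    rw [Cb4.norm_single_one, mul_one]
    exact hMK x
  have iD2Kij : ∀ i j : Fin N, Integrable (fun x =>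
      D.Cdot t i j * D2K x (EuclideanSpace.single i 1) (EuclideanSpace.single j 1)) Q :=
    fun i j => (Integrable.of_bound (cD2Kij i j).aestronglyMeasurable MK
      (Eventually.of_forall fun x => bD2Kij i j x)).const_mul _
  have iKd : Integrable Kd Q :=
    Integrable.of_bound hKdc.aestronglyMeasurable Kd0
      (Eventually.of_forall fun x => by rw [Real.norm_eq_abs]; exact hKdb x)
  have hsumint : (∑ i, ∑ j, D.Cdot t i j *
      ∫ x, D2K x (EuclideanSpace.single i 1) (EuclideanSpace.single j 1) ∂Q) =
      ∫ x, ∑ i, ∑ j, D.Cdot t i j * D2K x (EuclideanSpace.single i 1) (EuclideanSpace.single j 1) ∂Q := by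
    rw [integral_finsetSum _ fun i _ => integrable_finsetSum _ fun j _ => iD2Kij i j]
    refine Finset.sum_congr rfl fun i _ => ?_
    rw [integral_finsetSum _ fun j _ => iD2Kij i j]
    refine Finset.sum_congr rfl fun j _ => ?_
    rw [integral_const_mul]
  have iS : Integrable (fun x => ∑ i, ∑ j, D.Cdot t i j *
      D2K x (EuclideanSpace.single i 1) (EuclideanSpace.single j 1)) Q :=
    integrable_finsetSum _ fun i _ => integrable_finsetSum _ fun j _ => iD2Kij i j
  ---------------------------------------------------------------- the pointwise generator identity
  have ptwise : ∀ x, Kd x - (1 / 2) * ∑ i, ∑ j, D.Cdot t i j *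
      D2K x (EuclideanSpace.single i 1) (EuclideanSpace.single j 1) =
      -((∫ ζ, Ψ (x + ζ) ∂(P t)) * G' x) := by
    intro x
    have hZne : (∫ ζ, Ψ (x + ζ) ∂(P t)) ≠ 0 := (hZ x).ne'
    have hCs : ∀ i j, D.Cdot t j i = D.Cdot t i j := fun i j => D.Cdot_symm ht.le i j
    have h1 := jet_generator (n := Fin N) hCs hZne
      (W := ∫ ζ, Ψ (x + ζ) * F (x + ζ) ∂(P t))
      (Z1 := fun i => ∫ ζ, fderiv ℝ Ψ (x + ζ) (EuclideanSpace.single i 1) ∂(P t))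
      (W1 := fun i => ∫ ζ, fderiv ℝ (fun x => Ψ x * F x) (x + ζ) (EuclideanSpace.single i 1) ∂(P t))
      (g := fun k => g k x)
      (p := fun i => -(∫ ζ, fderiv ℝ Ψ (x + ζ) (EuclideanSpace.single i 1) ∂(P t)) /
        ∫ ζ, Ψ (x + ζ) ∂(P t))
      (Z2 := fun i j => ∫ ζ, fderiv ℝ (fderiv ℝ Ψ) (x + ζ)
        (EuclideanSpace.single i 1) (EuclideanSpace.single j 1) ∂(P t))
      (W2 := fun i j => ∫ ζ, fderiv ℝ (fderiv ℝ (fun x => Ψ x * F x)) (x + ζ)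
        (EuclideanSpace.single i 1) (EuclideanSpace.single j 1) ∂(P t))
      (N := fun i j => D2u x (EuclideanSpace.single i 1) (EuclideanSpace.single j 1))
      (Zd := Zd x) (Wd := Wd x)
      (ud := Wd x / (∫ ζ, Ψ (x + ζ) ∂(P t)) -
        (∫ ζ, Ψ (x + ζ) * F (x + ζ) ∂(P t)) * Zd x / (∫ ζ, Ψ (x + ζ) ∂(P t)) ^ 2)
      (fun i j => sm_fderiv₂_symm hΨ4 _ _ _ _) (fun i j => sm_fderiv₂_symm hΨF4 _ _ _ _)
      (fun k => by simp only [hg_def]; field_simp) (fun i => rfl)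
      (fun i j => by
        rw [hD2u, hZ1, hZ1, hW1, hW1, sm_fderiv₂_apply hΨ4 hB4, sm_fderiv₂_apply hΨF4 hBΨF4]
        ring)
      rfl rfl rfl
    -- rewrite the slope `K̇` through `u̇ = Wd/Z − W Zd/Z²`
    have hKd_alt : Kd x = Zd x * Φ (u x) + (∫ ζ, Ψ (x + ζ) ∂(P t)) *
        (Wd x / (∫ ζ, Ψ (x + ζ) ∂(P t)) -
          (∫ ζ, Ψ (x + ζ) * F (x + ζ) ∂(P t)) * Zd x / (∫ ζ, Ψ (x + ζ) ∂(P t)) ^ 2) * dΦ (u x) := by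
      simp only [hKd_def, hu_def]
      field_simp
      ring
    rw [hKd_alt, h1]
    -- expand the second jet of `K`
    simp only [hD2K_def, hG'_def, _root_.add_apply, _root_.smul_apply,
      ContinuousLinearMap.smulRight_apply, smul_eq_mul, hZ1, hgDu, sm_fderiv₂_apply hΨ4 hB4]
    -- bookkeeping of the double sums
    have e1 : ∑ i, ∑ j, D.Cdot t i j *
        ((∫ ζ, Ψ (x + ζ) ∂(P t)) * (dΦ (u x) * D2u x (EuclideanSpace.single i 1) (EuclideanSpace.single j 1) +
            d2Φ (u x) * g i x * g j x) +
          (∫ ζ, fderiv ℝ Ψ (x + ζ) (EuclideanSpace.single i 1) ∂(P t)) * (dΦ (u x) * g j x) +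
          (Φ (u x) * ∫ ζ, fderiv ℝ (fderiv ℝ Ψ) (x + ζ) (EuclideanSpace.single i 1)
              (EuclideanSpace.single j 1) ∂(P t) +
            dΦ (u x) * g i x * ∫ ζ, fderiv ℝ Ψ (x + ζ) (EuclideanSpace.single j 1) ∂(P t))) =
        (∫ ζ, Ψ (x + ζ) ∂(P t)) * dΦ (u x) *
            ∑ i, ∑ j, D.Cdot t i j * D2u x (EuclideanSpace.single i 1) (EuclideanSpace.single j 1) +
          (∫ ζ, Ψ (x + ζ) ∂(P t)) * d2Φ (u x) * ∑ i, ∑ j, D.Cdot t i j * (g i x * g j x) +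
          dΦ (u x) * ∑ i, ∑ j, D.Cdot t i j *
            ((∫ ζ, fderiv ℝ Ψ (x + ζ) (EuclideanSpace.single i 1) ∂(P t)) * g j x) +
          Φ (u x) * ∑ i, ∑ j, D.Cdot t i j * ∫ ζ, fderiv ℝ (fderiv ℝ Ψ) (x + ζ)
            (EuclideanSpace.single i 1) (EuclideanSpace.single j 1) ∂(P t) +
          dΦ (u x) * ∑ i, ∑ j, D.Cdot t i j *
            (g i x * ∫ ζ, fderiv ℝ Ψ (x + ζ) (EuclideanSpace.single j 1) ∂(P t)) := by
      simp only [Finset.mul_sum, ← Finset.sum_add_distrib]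
      refine Finset.sum_congr rfl fun i _ => Finset.sum_congr rfl fun j _ => ?_
      ring
    have eSym : ∑ i, ∑ j, D.Cdot t i j *
        (g i x * ∫ ζ, fderiv ℝ Ψ (x + ζ) (EuclideanSpace.single j 1) ∂(P t)) =
        ∑ i, ∑ j, D.Cdot t i j *
          ((∫ ζ, fderiv ℝ Ψ (x + ζ) (EuclideanSpace.single i 1) ∂(P t)) * g j x) := by
      rw [Finset.sum_comm]
      refine Finset.sum_congr rfl fun i _ => Finset.sum_congr rfl fun j _ => ?_
      rw [hCs i j]
      ring
    have eP : (∫ ζ, Ψ (x + ζ) ∂(P t)) * ∑ i, ∑ j, D.Cdot t i j *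
        (-(∫ ζ, fderiv ℝ Ψ (x + ζ) (EuclideanSpace.single i 1) ∂(P t)) / (∫ ζ, Ψ (x + ζ) ∂(P t)) *
          g j x) =
        -∑ i, ∑ j, D.Cdot t i j *
          ((∫ ζ, fderiv ℝ Ψ (x + ζ) (EuclideanSpace.single i 1) ∂(P t)) * g j x) := by
      rw [Finset.mul_sum, ← Finset.sum_neg_distrib]
      refine Finset.sum_congr rfl fun i _ => ?_
      rw [Finset.mul_sum, ← Finset.sum_neg_distrib]
      refine Finset.sum_congr rfl fun j _ => ?_
      field_simp
    have eZd : Zd x = (1 / 2) * ∑ i, ∑ j, D.Cdot t i j * ∫ ζ, fderiv ℝ (fderiv ℝ Ψ) (x + ζ)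
        (EuclideanSpace.single i 1) (EuclideanSpace.single j 1) ∂(P t) := rfl
    rw [e1, eSym, eZd]
    linear_combination (-dΦ (u x)) * eP

  have key : -((1 / 2) * ∑ i, ∑ j, D.Cdot t i j *
      ∫ x, D2K x (EuclideanSpace.single i 1) (EuclideanSpace.single j 1) ∂Q) + ∫ x, Kd x ∂Q =
      -∫ x, Real.exp (-renormPotential D V₀ t x) * G' x ∂Q := by
    rw [hR, hsumint, ← integral_const_mul, neg_add_eq_sub, ← integral_sub iKd (iS.const_mul _),
      ← integral_neg]
    refine integral_congr_ae (Eventually.of_forall fun x => ?_)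
    exact ptwise x
  show Real.exp (renormPotentialInf D V₀ 0) * (-((1 / 2) * ∑ i, ∑ j, D.Cdot t i j *
      ∫ x, D2K x (EuclideanSpace.single i 1) (EuclideanSpace.single j 1) ∂Q) + ∫ x, Kd x ∂Q) =
    -(Real.exp (renormPotentialInf D V₀ 0) * ∫ x, Real.exp (-renormPotential D V₀ t x) * G' x ∂Q)
  rw [key, mul_neg]

end Entropy

end Polchinski

end Literature.Analysis.FunctionSpaces

end
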